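import Mathlib
import HarnessLib
import Summits.Ventures.LatticeQCDFlow.Scaling.U1IdentityFlowDiagonalLimit
import Summits.Ventures.LatticeQCDFlow.Scaling.IdentityFlowCouplingWindow

/-!
# LatticeQCDFlow / Scaling — the U(1) untrained sampler in GEN-12's vocabulary: acceptance `→ 0`
# above the window `β√V → ∞`, `→ 1` below it `β√V → 0` (the window is `Θ(V^{−1/2})`)

HONEST FRAMING: exact (Metropolis-corrected) sampling algorithms for lattice gauge theory;
figures of merit are autocorrelation/cost numbers at stated couplings and volumes; no
continuum-physics claim.

Venture `LatticeQCDFlow` (cell pub-lqcd), topic `Scaling`; FANOUT row 3 (`s0-u1-a`, S0-B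
implementation A, GEN-19).  NEW WORK of the cell (dictionary reading of row 3's window theorem
`Scaling/IdentityFlowCouplingWindow` through `Scaling/U1IdentityFlowDiagonalLimit`'s identity
`u1IdentityFlow_meanAccept_eq_tilt`); NO definition is introduced; nothing is cited.

The acceptance functional of GEN-12's `Scaling/U1IdentityFlowVolumeLaw` — the untrained exact
sampler of `V` independent U(1) plaquettes (Haar proposal, Wilson one-plaquette target, densities
against Lebesgue measure on `(0, 2π]^V`) — satisfies, along any coupling sequence `β_V`:
* **`u1IdentityFlow_window_tendsto_zero`** — `β_V√V → ∞` ⇒ acceptance `→ 0`;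
* **`u1IdentityFlow_window_tendsto_one`** — `β_V ≥ 0`, `β_V√V → 0` ⇒ acceptance `→ 1`;
* (across the window, `β_V√V → c`: `→ erfc(|c|/(2√2))`, `Scaling/U1IdentityFlowDiagonalLimit`).

So the exponential-in-`V` acceptance decay of GEN-12/GEN-15 at fixed `β` and the `√V` strong-coupling
slope law of GEN-17/18 are the two ends of one statement: the useful coupling window of the
untrained U(1) sampler is exactly `β = Θ(V^{−1/2})`.

NOT CLAIMED: the torus; negative `β`; rates; any value at the cell's `(β, L)`; nothing re-scored.
-/

noncomputable section

namespace Summit.Ventures.LatticeQCDFlow.Theory2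

open MeasureTheory ProbabilityTheory Filter Finset Real Set
open scoped Topology NNReal
open Summit.Ventures.LatticeQCDFlow.Scoring Literature.Analysis.FunctionSpaces

section U1Window

/-- **ABOVE THE WINDOW (U(1), GEN-12 vocabulary)**: `β_V√V → ∞` ⇒ the equilibrium acceptance of the
untrained factorised U(1) sampler `→ 0`. [ours] -/
theorem u1IdentityFlow_window_tendsto_zero {β : ℕ → ℝ}
    (hβ : Tendsto (fun n : ℕ => β n * Real.sqrt n) atTop atTop) :
    Tendsto (fun n : ℕ =>
        ∫ x, ∫ x', min ((∏ i : Fin n, Real.exp (β n * Real.cos (x i)) / onePlaquetteZ (β n))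
              * ∏ _i : Fin n, (1 / (2 * π) : ℝ))
            ((∏ i : Fin n, Real.exp (β n * Real.cos (x' i)) / onePlaquetteZ (β n))
              * ∏ _i : Fin n, (1 / (2 * π) : ℝ))
          ∂(Measure.pi fun _ : Fin n => volume.restrict (Ioc (0 : ℝ) (2 * π)))
          ∂(Measure.pi fun _ : Fin n => volume.restrict (Ioc (0 : ℝ) (2 * π))))
      atTop (𝓝 0) := by
  haveI : IsProbabilityMeasure ((ENNReal.ofReal (2 * π))⁻¹ • volume.restrict (Ioc (0 : ℝ) (2 * π))) :=
    ⟨by rw [Measure.smul_apply, Measure.restrict_apply_univ, Real.volume_Ioc, sub_zero, smul_eq_mul,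
      ENNReal.inv_mul_cancel (ENNReal.ofReal_pos.2 (by positivity : (0 : ℝ) < 2 * π)).ne'
        ENNReal.ofReal_ne_top]⟩
  have hσ : Var[fun θ => Real.cos θ; (ENNReal.ofReal (2 * π))⁻¹ • volume.restrict (Ioc (0 : ℝ) (2 * π))]
      ≠ 0 := by rw [variance_cos_uniform]; norm_num
  have h := tiltPi_meanAccept_tendsto_zero_of_bounded
    (ν := (ENNReal.ofReal (2 * π))⁻¹ • volume.restrict (Ioc (0 : ℝ) (2 * π)))
    (g := fun θ => Real.cos θ) Real.continuous_cos.measurable (K := 1)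
    (fun θ => Real.abs_cos_le_one θ) hσ hβ
  refine h.congr fun n => ?_
  exact (u1IdentityFlow_meanAccept_eq_tilt (ι := Fin n) (β n)).symm

/-- **BELOW THE WINDOW (U(1), GEN-12 vocabulary)**: `β_V ≥ 0` with `β_V√V → 0` ⇒ the acceptance
`→ 1`. [ours] -/
theorem u1IdentityFlow_window_tendsto_one {β : ℕ → ℝ} (hβ0 : ∀ n, 0 ≤ β n)
    (hβ : Tendsto (fun n : ℕ => β n * Real.sqrt n) atTop (𝓝 0)) :
    Tendsto (fun n : ℕ =>
        ∫ x, ∫ x', min ((∏ i : Fin n, Real.exp (β n * Real.cos (x i)) / onePlaquetteZ (β n))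
              * ∏ _i : Fin n, (1 / (2 * π) : ℝ))
            ((∏ i : Fin n, Real.exp (β n * Real.cos (x' i)) / onePlaquetteZ (β n))
              * ∏ _i : Fin n, (1 / (2 * π) : ℝ))
          ∂(Measure.pi fun _ : Fin n => volume.restrict (Ioc (0 : ℝ) (2 * π)))
          ∂(Measure.pi fun _ : Fin n => volume.restrict (Ioc (0 : ℝ) (2 * π))))
      atTop (𝓝 1) := by
  haveI : IsProbabilityMeasure ((ENNReal.ofReal (2 * π))⁻¹ • volume.restrict (Ioc (0 : ℝ) (2 * π))) :=
    ⟨by rw [Measure.smul_apply, Measure.restrict_apply_univ, Real.volume_Ioc, sub_zero, smul_eq_mul,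
      ENNReal.inv_mul_cancel (ENNReal.ofReal_pos.2 (by positivity : (0 : ℝ) < 2 * π)).ne'
        ENNReal.ofReal_ne_top]⟩
  have hσ : Var[fun θ => Real.cos θ; (ENNReal.ofReal (2 * π))⁻¹ • volume.restrict (Ioc (0 : ℝ) (2 * π))]
      ≠ 0 := by rw [variance_cos_uniform]; norm_num
  have h := tiltPi_meanAccept_tendsto_one_of_bounded
    (ν := (ENNReal.ofReal (2 * π))⁻¹ • volume.restrict (Ioc (0 : ℝ) (2 * π)))
    (g := fun θ => Real.cos θ) Real.continuous_cos.measurable (K := 1)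
    (fun θ => Real.abs_cos_le_one θ) hσ hβ0 hβ
  refine h.congr fun n => ?_
  exact (u1IdentityFlow_meanAccept_eq_tilt (ι := Fin n) (β n)).symm

end U1Window

end Summit.Ventures.LatticeQCDFlow.Theory2

end
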